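import Literature.Geometry.Kaehler.ComplexTorusMixedHodgeRiemannForm
import HarnessLib

/-!
# Timorin's theorem on a complex torus: the mixed Hodge–Riemann bilinear relations and mixed hard Lefschetz
# in EVERY bidegree, by the deformation argument

Layer `Literature/Geometry/Kaehler`, namespace `Literature.Geometry.Kaehler.ComplexTorus`; lane `lit-hodgefound`
(Track 2, HodgeConjecture), file T4b — the last file of the programme "mixed Hodge–Riemann bilinear relations in
every bidegree on a complex torus" (T1 `LinearAlgebra/QuadraticForm/SignatureContinuousFamily`, T2
`ComplexTorusMixedLefschetzDecomposition`, T3 `ComplexTorusHyperplaneRestriction`, T4a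
`ComplexTorusMixedHodgeRiemannForm`). Everything here is PROVED; no named facts.

**Theorem (Timorin 1998; Dinh–Nguyên 2006, Prop. 2.1; Cattani 2008, Thm. 2.2 for this case).** Let `E` be a
complex vector space of dimension `g = n + p + q`, `θ_0, …, θ_n` real `2`-forms with `θ_j(i·, i·) = θ_j` and
`θ_j(iv, v) > 0` (`v ≠ 0`) — i.e. `ω_j = -θ_j` Kähler — and `A ≠ 0` a form of type `(p, q)` with
`θ_0 ∧ ⋯ ∧ θ_n ∧ A = 0` (mixed primitive). Then
`ε(p+q, p, q) · ((-θ_0)_ℂ ∧ ⋯ ∧ (-θ_{n-1})_ℂ ∧ A ∧ Ā)(u_1, iu_1, …, u_g, iu_g) > 0` for every complex basis `u`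
(`mixedHodgeRiemann_frame`; `ε(k,p,q) = (-1)^{k(k-1)/2} i^{p-q}`), equivalently on a complex torus `X = E/Λ`:
`ε ∫_X (-θ_0)_ℂ ∧ ⋯ ∧ (-θ_{n-1})_ℂ ∧ A ∧ Ā > 0` (`mixedHodgeRiemann_torusIntegral_pos`). Consequences: mixed hard
Lefschetz in every bidegree (`mixedHardLefschetz_of_pos`: `A ↦ θ_0 ∧ ⋯ ∧ θ_n ∧ A` is injective on `Λ^{p,q}`,
`dim E = n + 1 + p + q`), and Dinh–Nguyên's Prop. 2.1 (b): the Hodge–Riemann form is positive definite on the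
mixed primitive part of `Λ^{p,q}` (`posDef_hrFormPQ_restrict_primitiveReal_of_pos`,
`posDef_hrFormPQ_of_pos_of_fst_eq_zero_or_snd_eq_zero`).

**Proof (Timorin's induction on `dim E`, as organised in T3/T4a).** `mixedHodgeRiemann_frame_aux N`: the frame
statement for all `E` with `dim E = N`. Step `N ⇒ N + 1`: (1) mixed hard Lefschetz on `E` for every positive
background of the right length, from the induction hypothesis on the hyperplanes `ker ξ` (T3
`eq_zero_of_wedgeFamily_wedge_eq_zero_of_hyperplanes`: Chirka's diagonalisation `Θ_n = Σ c_a π_{w_a^*}`, the slice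
formula, and "`Q(A, ω∧·) = 0 ⇒ Q(A, A) ≤ 0` on each hyperplane"); (2) choose a real frame `Φ : ℝ^{2g} ≃ E`, so that
`E` carries the torus structure of T4a, and run the deformation argument (§2): by T1 the indices of inertia of
`h_θ = Re(ε ∫ Ω(θ) ∧ A ∧ B̄)|_{Λ^{p,q}}` are constant along the CONVEX cone of positive backgrounds (the form is
non-degenerate throughout by (1) and T2, and continuous in `θ`); in bidegree `(p+1, q+1)` the `h`-orthogonal
mixed Lefschetz decomposition `Λ^{p+1,q+1} = P_θ ⊕ ω ∧ Λ^{p,q}` (T2/T4a) gives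
`b⁺(h_θ) = b⁺(h_θ|P_θ) + b⁻(h^{(p+q)}_{(θ,ω,ω)})`, with `b⁻(h^{(p+q)})` again constant by T1 and `dim P_θ` constant
by T2; at the classical point `θ = (η, …, η)` the form is positive definite on `P` (Voisin's Thm. 6.32, tree
`hodgeRiemann_voisin_of_pos`), so `b⁺(h_θ|P_θ) = dim P_θ`, i.e. `h_θ|P_θ` is positive definite; in bidegrees
`(0, q)`, `(p, 0)` everything is primitive and `b⁺(h_θ) = dim Λ^{p,q}` directly. (3) `h_θ(A, A) > 0` is the
frame inequality (T4a `hrSign_mul_apply_interleave_pos_iff`). Base `N = 0`: `A` is a non-zero constant and the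
value is `|A()|² > 0`.

## Contents

* §1 `positiveTuples E n` (the cone of positive backgrounds): convex; closed under dropping / repeating the last
  form; mixed hard Lefschetz for the empty background;
* §2 the deformation argument on a fixed torus: `sigPos_sigNeg_hrFormPQ_eq_of_mem_positiveTuples` (constancy of
  `b^±` given mixed HL), `posDef_hrFormPQ_of_primitiveReal_eq_top` (bidegrees `(0,q)`, `(p,0)`),
  `posDef_hrFormPQ_restrict_primitiveReal` (bidegree `(p+1,q+1)`, given mixed HL in lengths `n` and `n + 2`);
* §3 from `h(A, A) > 0` to the frame inequality; `0`-forms;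
* §4 `mixedHodgeRiemann_frame_aux` — the induction;
* §5 the theorems listed above.

## Sources

* V. A. Timorin, *Mixed Hodge–Riemann bilinear relations in a linear context*, Funct. Anal. Appl. 32 (1998),
  268–272 — Main Theorem (the linear mixed HR relations; proof by deformation / induction on hyperplanes; cited
  through Dinh–Nguyên, who write "we also obtain … using a result of Timorin [Prop. 2.1]"). [Timorin1998]
* T.-C. Dinh, V.-A. Nguyên, *The mixed Hodge–Riemann bilinear relations for compact Kähler manifolds*, GAFA 16
  (2006), §2 Prop. 2.1 (a)–(c) (arXiv PDF p. 5), §1 Thm. 1.3 / Theorems A–C. [DinhNguyen2006]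
* E. Cattani, *Mixed Lefschetz theorems and Hodge–Riemann bilinear relations*, IMRN 2008, Thm. 2.2.
  [Cattani2008MixedLefschetz]
* Y. Shenfeld, R. van Handel, *Mixed volumes and the Bochner method*, Proc. AMS 147 (2019), §4 Lemma 4.2 (the
  induction on dimension through hyperplanes, "hyperbolic quadratic forms" Lemma 2.9). [ShenfeldVanHandel2019]
* J. Gregory, *Quadratic Form Theory and Differential Equations* (1980), Ch. 2 §2.3 Thm. 5 / Cor. 8 (signature of
  a continuous non-degenerate family is locally constant; chunks p0086–p0087). [Gregory1980QuadraticForms]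
* C. Voisin, *Hodge Theory and Complex Algebraic Geometry I* (2002), §6.3.2 Thm. 6.32 (classical Hodge–Riemann),
  §6.2.3. [VoisinHodgeI2002]
* H. Lange, *Abelian Varieties over the Complex Numbers* (2023), §1.7.2 Lemma 1.7.5 (top forms and `∫_X`).
  [Lange2023AbelianVarietiesComplex]
* F. W. Warner, *Foundations of Differentiable Manifolds and Lie Groups*, GTM 94, 2.6. [WarnerGTM94]
-/

noncomputable section

set_option maxSynthPendingDepth 3

open scoped ComplexConjugate ComplexOrder
open Complex Function Module
open Literature.LinearAlgebra.Alternating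
open Literature.Analysis.Complex (oneForm₀ IsOfTypeAt typeSubmodule isOfTypeAt_of_mem_typeSubmodule)

namespace Literature.Geometry.Kaehler

namespace ComplexTorus

universe u

open Literature.LinearAlgebra.QuadraticForm

/-! ## §1 The convex cone of positive `(1,1)` backgrounds -/

section Cone

variable {E : Type*} [NormedAddCommGroup E] [NormedSpace ℂ E]

/-- **The cone of `n`-tuples of positive real `(1,1)`-forms** (`θ(iu, iv) = θ(u, v)`, `θ(iv, v) > 0` for `v ≠ 0`:
the Kähler forms `ω = -θ` of the tree's convention; Dinh–Nguyên's "`ω_1, …, ω_{n-p-q+1}` strictly positive forms of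
`Λ^{1,1}`"). [cite: DinhNguyen2006, §2 Prop. 2.1 (arXiv PDF p. 5)] -/
def positiveTuples (E : Type*) [NormedAddCommGroup E] [NormedSpace ℂ E] (n : ℕ) :
    Set (Fin n → E [⋀^Fin 2]→L[ℝ] ℝ) :=
  {t | ∀ j, (∀ x y : E, t j ![I • x, I • y] = t j ![x, y]) ∧ ∀ v : E, v ≠ 0 → 0 < t j ![I • v, v]}

/-- Membership. [cite: DinhNguyen2006, §2 Prop. 2.1 (arXiv PDF p. 5)] -/
theorem mem_positiveTuples_iff {n : ℕ} (t : Fin n → E [⋀^Fin 2]→L[ℝ] ℝ) :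
    t ∈ positiveTuples E n ↔
      ∀ j, (∀ x y : E, t j ![I • x, I • y] = t j ![x, y]) ∧ ∀ v : E, v ≠ 0 → 0 < t j ![I • v, v] :=
  Iff.rfl

/-- **The positive backgrounds form a CONVEX set** (indeed an open convex cone) — the parameter space of the
deformation argument is connected. [cite: DinhNguyen2006, §2 Prop. 2.1 (arXiv PDF p. 5)]
[cite: Gregory1980QuadraticForms, Ch. 2 §2.3 Cor. 8 (chunk p0087)] -/
theorem convex_positiveTuples (n : ℕ) : Convex ℝ (positiveTuples E n) := by
  intro a ha b hb μ ν hμ hν hμν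
  refine fun j ↦ ⟨fun x y ↦ ?_, fun v hv ↦ ?_⟩
  · simp only [Pi.add_apply, Pi.smul_apply, ContinuousAlternatingMap.add_apply, ContinuousAlternatingMap.smul_apply,
      (ha j).1 x y, (hb j).1 x y]
  · simp only [Pi.add_apply, Pi.smul_apply, ContinuousAlternatingMap.add_apply, ContinuousAlternatingMap.smul_apply,
      smul_eq_mul]
    have ha' := (ha j).2 v hv
    have hb' := (hb j).2 v hv
    rcases hμ.lt_or_eq with hμ' | hμ'
    · exact add_pos_of_pos_of_nonneg (mul_pos hμ' ha') (mul_nonneg hν hb'.le)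
    · rw [← hμ', zero_mul, zero_add]
      rw [← hμ', zero_add] at hμν
      rw [hμν, one_mul]
      exact hb'

/-- A constant tuple of one positive form is a positive tuple. [cite: DinhNguyen2006, §2 Prop. 2.1 (arXiv PDF p. 5)] -/
theorem const_mem_positiveTuples {η : E [⋀^Fin 2]→L[ℝ] ℝ} (h11 : ∀ x y : E, η ![I • x, I • y] = η ![x, y])
    (hpos : ∀ v : E, v ≠ 0 → 0 < η ![I • v, v]) (n : ℕ) : (fun _ : Fin n ↦ η) ∈ positiveTuples E n :=
  fun _ ↦ ⟨h11, hpos⟩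

/-- Dropping the last form keeps positivity. [cite: DinhNguyen2006, §2 Prop. 2.1 (arXiv PDF p. 5)] -/
theorem castSucc_mem_positiveTuples {n : ℕ} {t : Fin (n + 1) → E [⋀^Fin 2]→L[ℝ] ℝ}
    (ht : t ∈ positiveTuples E (n + 1)) : (fun j ↦ t (Fin.castSucc j)) ∈ positiveTuples E n :=
  fun j ↦ ht (Fin.castSucc j)

/-- Repeating the last form keeps positivity. [cite: DinhNguyen2006, §2 Prop. 2.1 (c) (arXiv PDF p. 5)] -/
theorem snoc_mem_positiveTuples {n : ℕ} {t : Fin (n + 1) → E [⋀^Fin 2]→L[ℝ] ℝ}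
    (ht : t ∈ positiveTuples E (n + 1)) :
    Fin.snoc (α := fun _ ↦ E [⋀^Fin 2]→L[ℝ] ℝ) t (t (Fin.last n)) ∈ positiveTuples E (n + 2) := by
  intro j
  refine Fin.lastCases ?_ (fun i ↦ ?_) j
  · simp only [Fin.snoc_last]; exact ht _
  · simp only [Fin.snoc_castSucc]; exact ht _

/-- Complexifying commutes with repeating the last form. [cite: DinhNguyen2006, §2 Prop. 2.1 (c) (arXiv PDF p. 5)] -/
theorem ofRealForm_neg_snoc {n : ℕ} (t : Fin (n + 1) → E [⋀^Fin 2]→L[ℝ] ℝ) :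
    (fun j ↦ ofRealForm (-(Fin.snoc (α := fun _ ↦ E [⋀^Fin 2]→L[ℝ] ℝ) t (t (Fin.last n)) j))) =
      Fin.snoc (α := fun _ ↦ E [⋀^Fin 2]→L[ℝ] ℂ) (fun j ↦ ofRealForm (-(t j))) (ofRealForm (-(t (Fin.last n)))) := by
  funext j
  refine Fin.lastCases ?_ (fun i ↦ ?_) j
  · simp only [Fin.snoc_last]
  · simp only [Fin.snoc_castSucc]

/-- The complexified family of a positive tuple is of type `(1,1)`. [cite: VoisinHodgeI2002, §2.3.1] -/
theorem isOfTypeAt_of_mem_positiveTuples {n : ℕ} {t : Fin n → E [⋀^Fin 2]→L[ℝ] ℝ} (ht : t ∈ positiveTuples E n)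
    (j : Fin n) : IsOfTypeAt 1 1 (ofRealForm (-(t j))) :=
  isOfTypeAt_ofRealForm_neg_family (fun j ↦ (ht j).1) j

/-- **Mixed hard Lefschetz for the EMPTY background is trivial**: `1 ∧ A = 0 ⇒ A = 0`. [cite: WarnerGTM94, 2.6] -/
theorem eq_zero_of_wedgeFamily_zero_wedge_eq_zero {k : ℕ} (Θ : Fin 0 → E [⋀^Fin 2]→L[ℝ] ℂ)
    {A : E [⋀^Fin k]→L[ℝ] ℂ} (h : (wedgeFamily 0 Θ).wedge A = 0) : A = 0 := by
  have h1 : (wedgeFamily 0 Θ).wedge A = A.domDomCongr (finCongr (Nat.zero_add k).symm) :=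
    ContinuousAlternatingMap.constOfIsEmpty_one_wedge A
  rw [h1] at h
  exact (domDomCongr_finCongr_eq_zero_iff _).1 h

end Cone

/-! ## §2 The deformation argument on a fixed torus: signatures are constant along the cone of positive backgrounds -/

section Deformation

variable {ι : Type*} [Fintype ι] [DecidableEq ι] {E : Type*} [NormedAddCommGroup E] [NormedSpace ℂ E]
  (Φ : (ι → ℝ) ≃L[ℝ] E)

/-- **The indices of inertia of `h = Re(ε(k,p,q) ∫_X Ω(θ) ∧ A ∧ B̄)` on `Λ^{p,q}` do not depend on the positive
background `θ = (θ_1, …, θ_n)`**, provided mixed hard Lefschetz holds on `Λ^{p,q}` for every positive background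
(so that `h` is non-degenerate throughout): the entries are continuous in `θ`, the positive backgrounds form a convex
set, and a continuous non-degenerate family of quadratic forms on a connected set has constant signature (T1,
`sigPos_eq_of_convex`). This is the deformation step of Timorin's proof. [cite: Timorin1998, Main Theorem]
[cite: DinhNguyen2006, §2 Prop. 2.1 (a), (b) (arXiv PDF p. 5)] [cite: Gregory1980QuadraticForms, Ch. 2 §2.3 Cor. 8 (chunk p0087)] -/
theorem sigPos_sigNeg_hrFormPQ_eq_of_mem_positiveTuples {g n k p q : ℕ} (e : Fin (2 * g) ≃ ι) (hnk : n + k = g)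
    (hpq : p + q = k) (h2 : 2 * n + (k + k) = 2 * g)
    (hHL : ∀ s ∈ positiveTuples E n, ∀ A ∈ typeSubmodule E k p q,
      (wedgeFamily n fun j ↦ ofRealForm (-(s j))).wedge A = 0 → A = 0)
    {s t : Fin n → E [⋀^Fin 2]→L[ℝ] ℝ} (hs : s ∈ positiveTuples E n) (ht : t ∈ positiveTuples E n) :
    sigPos (hrFormPQ Φ e (hrSign k p q) (wedgeFamily n fun j ↦ ofRealForm (-(s j))) h2 p q).toQuadraticMap =
        sigPos (hrFormPQ Φ e (hrSign k p q) (wedgeFamily n fun j ↦ ofRealForm (-(t j))) h2 p q).toQuadraticMap ∧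
      sigNeg (hrFormPQ Φ e (hrSign k p q) (wedgeFamily n fun j ↦ ofRealForm (-(s j))) h2 p q).toQuadraticMap =
        sigNeg (hrFormPQ Φ e (hrSign k p q) (wedgeFamily n fun j ↦ ofRealForm (-(t j))) h2 p q).toQuadraticMap := by
  haveI := finiteDimensional_complex Φ
  haveI : FiniteDimensional ℝ (E [⋀^Fin k]→L[ℝ] ℂ) := finiteDimensional_real_complexForms
  have hcont : ∀ x y : ↥((typeSubmodule E k p q).restrictScalars ℝ),
      ContinuousOn (fun r : Fin n → E [⋀^Fin 2]→L[ℝ] ℝ ↦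
        hrFormPQ Φ e (hrSign k p q) (wedgeFamily n fun j ↦ ofRealForm (-(r j))) h2 p q x y) (positiveTuples E n) := by
    intro x y
    have h := continuous_hrForm_wedgeFamily Φ e (hrSign k p q) h2 (θ := fun (r : Fin n → E [⋀^Fin 2]→L[ℝ] ℝ) j ↦ r j)
      (fun j ↦ continuous_apply j) (x : E [⋀^Fin k]→L[ℝ] ℂ) (y : E [⋀^Fin k]→L[ℝ] ℂ)
    simp only [hrForm_apply] at h
    simp only [hrFormPQ_apply]
    exact h.continuousOn
  have hrad : ∀ r ∈ positiveTuples E n,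
      (hrFormPQ Φ e (hrSign k p q) (wedgeFamily n fun j ↦ ofRealForm (-(r j))) h2 p q).toQuadraticMap.radical = ⊥ :=
    fun r hr ↦ radical_hrFormPQ_eq_bot (isOfTypeAt_of_mem_positiveTuples hr) (conjForm_ofRealForm_neg_family r) hnk hpq
      h2 (conj_hrSign hpq) (hrSign_ne_zero k p q) (hHL r hr)
  exact ⟨sigPos_eq_of_convex (V := ↥((typeSubmodule E k p q).restrictScalars ℝ))
      (fun r : Fin n → E [⋀^Fin 2]→L[ℝ] ℝ ↦ hrFormPQ Φ e (hrSign k p q) (wedgeFamily n fun j ↦ ofRealForm (-(r j))) h2 p q)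
      (convex_positiveTuples n) hcont hrad hs ht,
    sigNeg_eq_of_convex (V := ↥((typeSubmodule E k p q).restrictScalars ℝ))
      (fun r : Fin n → E [⋀^Fin 2]→L[ℝ] ℝ ↦ hrFormPQ Φ e (hrSign k p q) (wedgeFamily n fun j ↦ ofRealForm (-(r j))) h2 p q)
      (convex_positiveTuples n) hcont hrad hs ht⟩

/-- A form is positive definite once its restriction to `⊤` is. [folklore] -/
private theorem posDef_of_posDef_restrict_top {V : Type*} [AddCommGroup V] [Module ℝ V] {Q : QuadraticForm ℝ V}
    (h : (Q.restrict ⊤).PosDef) : Q.PosDef := fun x hx ↦ by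
  have h1 := h ⟨x, Submodule.mem_top⟩ (fun h0 ↦ hx (congrArg Subtype.val h0))
  rwa [QuadraticMap.restrict_apply] at h1

/-- **The deformation argument when every form is primitive** (bidegrees `(0, q)`, `(p, 0)`): if `P_θ ∩ Λ^{p,q}` is
all of `Λ^{p,q}` for every positive background, then `h_θ` is positive definite on `Λ^{p,q}` for every positive
`θ` — it is so at the classical point `(η, …, η)` (Voisin's Thm. 6.32), and the positive index of inertia is
constant along the convex cone of positive backgrounds. [cite: Timorin1998, Main Theorem]
[cite: DinhNguyen2006, §2 Prop. 2.1 (b) (arXiv PDF p. 5)] [cite: VoisinHodgeI2002, §6.3.2 Thm. 6.32] -/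
theorem posDef_hrFormPQ_of_primitiveReal_eq_top {g n k p q : ℕ} (e : Fin (2 * g) ≃ ι) (hnk : n + k = g)
    (hpq : p + q = k) (h2 : 2 * n + (k + k) = 2 * g)
    (hHL : ∀ s ∈ positiveTuples E n, ∀ A ∈ typeSubmodule E k p q,
      (wedgeFamily n fun j ↦ ofRealForm (-(s j))).wedge A = 0 → A = 0)
    (htop : ∀ t ∈ positiveTuples E (n + 1), primitiveReal (fun j ↦ ofRealForm (-(t j))) k p q = ⊤)
    {t : Fin (n + 1) → E [⋀^Fin 2]→L[ℝ] ℝ} (ht : t ∈ positiveTuples E (n + 1)) :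
    (hrFormPQ Φ e (hrSign k p q) (wedgeFamily n fun j ↦ ofRealForm (-(t (Fin.castSucc j)))) h2 p q).toQuadraticMap.PosDef := by
  haveI := finiteDimensional_complex Φ
  haveI : FiniteDimensional ℝ (E [⋀^Fin k]→L[ℝ] ℂ) := finiteDimensional_real_complexForms
  -- the classical point `(η, …, η)`, `η = θ_n`
  have h11 := (ht (Fin.last n)).1
  have hpos := (ht (Fin.last n)).2
  have h0 : (hrFormPQ Φ e (hrSign k p q) (wedgeFamily n fun _ : Fin n ↦ ofRealForm (-(t (Fin.last n)))) h2 p q)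
      |>.toQuadraticMap.PosDef := by
    have h := posDef_hrFormPQ_restrict_primitiveReal_const Φ e hnk hpq h2 h11 hpos
    rw [htop _ (const_mem_positiveTuples h11 hpos (n + 1))] at h
    exact posDef_of_posDef_restrict_top h
  -- signature constancy between `(θ_0, …, θ_{n-1})` and `(η, …, η)`
  have hsig := (sigPos_sigNeg_hrFormPQ_eq_of_mem_positiveTuples Φ e hnk hpq h2 hHL (castSucc_mem_positiveTuples ht)
    (const_mem_positiveTuples h11 hpos n)).1
  refine posDef_of_finrank_le_sigPos ?_
  rw [hsig, sigPos_eq_finrank_of_posDef h0]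

/-- **The deformation argument in bidegree `(p+1, q+1)`** (dimension `g = n + p + q + 2`, background `(θ_0, …, θ_n)`
positive, `ω = θ_n`): assuming mixed hard Lefschetz for all positive backgrounds of lengths `n` (on `Λ^{p+1,q+1}`)
and `n + 2` (on `Λ^{p,q}`), the form `h_θ = Re(ε ∫ θ_0 ∧ ⋯ ∧ θ_{n-1} ∧ A ∧ B̄)` is POSITIVE DEFINITE on the mixed
primitive forms `P_θ ∩ Λ^{p+1,q+1}`. Proof (Timorin): `b⁺(h_θ) = b⁺(h_θ|P_θ) + b⁺(h_θ|ω∧Λ^{p,q})` (the `h`-orthogonal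
mixed Lefschetz decomposition), `b⁺(h_θ|ω∧Λ^{p,q}) = b⁻(h^{(p+q)}_{(θ,ω,ω)})` (the isometry `C ↦ C ∧ ω` and
`ε(k+2) = -ε(k)`), both `b⁺(h_θ)` and `b⁻(h^{(p+q)})` are constant along the convex cones of positive backgrounds
(T1), `dim P_θ` is constant (T2), and at the classical point `h` is positive definite on `P` (Voisin's Thm. 6.32);
hence `b⁺(h_θ|P_θ) = dim P_θ`. [cite: Timorin1998, Main Theorem] [cite: DinhNguyen2006, §2 Prop. 2.1 (a)–(c) (arXiv PDF p. 5)]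
[cite: VoisinHodgeI2002, §6.3.2 Thm. 6.32] [cite: Gregory1980QuadraticForms, Ch. 2 §2.3 Cor. 8 (chunk p0087)] -/
theorem posDef_hrFormPQ_restrict_primitiveReal {g n m p q : ℕ} (e : Fin (2 * g) ≃ ι) (hg : finrank ℂ E = g)
    (hpq : p + q = m) (hnk : n + (m + 2) = g) (h2 : 2 * n + ((m + 2) + (m + 2)) = 2 * g)
    (h2' : 2 * (n + 2) + (m + m) = 2 * g)
    (hHL₁ : ∀ s ∈ positiveTuples E n, ∀ A ∈ typeSubmodule E (m + 2) (p + 1) (q + 1),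
      (wedgeFamily n fun j ↦ ofRealForm (-(s j))).wedge A = 0 → A = 0)
    (hHL₂ : ∀ s ∈ positiveTuples E (n + 2), ∀ C ∈ typeSubmodule E m p q,
      (wedgeFamily (n + 2) fun j ↦ ofRealForm (-(s j))).wedge C = 0 → C = 0)
    {t : Fin (n + 1) → E [⋀^Fin 2]→L[ℝ] ℝ} (ht : t ∈ positiveTuples E (n + 1)) :
    ((hrFormPQ Φ e (hrSign (m + 2) (p + 1) (q + 1)) (wedgeFamily n (Fin.init fun j ↦ ofRealForm (-(t j)))) h2
        (p + 1) (q + 1)).toQuadraticMap.restrict (primitiveReal (fun j ↦ ofRealForm (-(t j))) (m + 2) (p + 1) (q + 1))).PosDef := by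
  haveI := finiteDimensional_complex Φ
  haveI : FiniteDimensional ℝ (E [⋀^Fin (m + 2)]→L[ℝ] ℂ) := finiteDimensional_real_complexForms
  have hσ : conj (hrSign (m + 2) (p + 1) (q + 1)) = (-1) ^ (m + 2) * hrSign (m + 2) (p + 1) (q + 1) :=
    conj_hrSign (by omega)
  have hσ0 := hrSign_ne_zero (m + 2) (p + 1) (q + 1)
  -- for every positive `(n+1)`-tuple `r`: the hypotheses of the T4a lemmas
  have hΘ : ∀ {r : Fin (n + 1) → E [⋀^Fin 2]→L[ℝ] ℝ}, r ∈ positiveTuples E (n + 1) →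
      ∀ j, IsOfTypeAt 1 1 ((fun j ↦ ofRealForm (-(r j))) j) := fun hr ↦ isOfTypeAt_of_mem_positiveTuples hr
  have hΘr : ∀ (r : Fin (n + 1) → E [⋀^Fin 2]→L[ℝ] ℝ) (j : Fin (n + 1)),
      conjForm ((fun j ↦ ofRealForm (-(r j))) j) = (fun j ↦ ofRealForm (-(r j))) j :=
    fun r ↦ conjForm_ofRealForm_neg_family r
  have hHL₁' : ∀ {r : Fin (n + 1) → E [⋀^Fin 2]→L[ℝ] ℝ}, r ∈ positiveTuples E (n + 1) →
      ∀ A ∈ typeSubmodule E (m + 2) (p + 1) (q + 1),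
        (wedgeFamily n (Fin.init fun j ↦ ofRealForm (-(r j)))).wedge A = 0 → A = 0 :=
    fun hr ↦ hHL₁ _ (castSucc_mem_positiveTuples hr)
  have hHL₂' : ∀ {r : Fin (n + 1) → E [⋀^Fin 2]→L[ℝ] ℝ}, r ∈ positiveTuples E (n + 1) →
      ∀ C ∈ typeSubmodule E m p q,
        (wedgeFamily (n + 2) (Fin.snoc (α := fun _ ↦ E [⋀^Fin 2]→L[ℝ] ℂ) (fun j ↦ ofRealForm (-(r j)))
          (ofRealForm (-(r (Fin.last n)))))).wedge C = 0 → C = 0 := by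
    intro r hr C hC h0
    rw [← ofRealForm_neg_snoc] at h0
    exact hHL₂ _ (snoc_mem_positiveTuples hr) C hC h0
  -- (1)+(2) for every positive `r`: `b⁺(h_r) = b⁺(h_r|P_r) + b⁻(h^{(m)}_{(r, r_n)})`
  have hsplit : ∀ {r : Fin (n + 1) → E [⋀^Fin 2]→L[ℝ] ℝ}, r ∈ positiveTuples E (n + 1) →
      sigPos (hrFormPQ Φ e (hrSign (m + 2) (p + 1) (q + 1)) (wedgeFamily n (Fin.init fun j ↦ ofRealForm (-(r j)))) h2
          (p + 1) (q + 1)).toQuadraticMap =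
        sigPos ((hrFormPQ Φ e (hrSign (m + 2) (p + 1) (q + 1)) (wedgeFamily n (Fin.init fun j ↦ ofRealForm (-(r j))))
          h2 (p + 1) (q + 1)).toQuadraticMap.restrict (primitiveReal (fun j ↦ ofRealForm (-(r j))) (m + 2) (p + 1) (q + 1))) +
        sigNeg (hrFormPQ Φ e (hrSign m p q) (wedgeFamily (n + 2) fun j ↦ ofRealForm
          (-(Fin.snoc (α := fun _ ↦ E [⋀^Fin 2]→L[ℝ] ℝ) r (r (Fin.last n)) j))) h2' p q).toQuadraticMap := by
    intro r hr
    have h1 := (sigPos_sigNeg_hrFormPQ_eq_add Φ hg hpq hnk e hσ hσ0 (hΘ hr) (hΘr r) h2 (hHL₁' hr) (hHL₂' hr)).1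
    have h3 := (sigPos_sigNeg_restrict_lefschetzReal_eq Φ e (hrSign (m + 2) (p + 1) (q + 1)) hpq (hΘ hr)
      (hΘr r (Fin.last n)) h2 h2' (hHL₂' hr)).1
    have h4 : sigPos (hrFormPQ Φ e (hrSign (m + 2) (p + 1) (q + 1)) (wedgeFamily (n + 2)
        (Fin.snoc (α := fun _ ↦ E [⋀^Fin 2]→L[ℝ] ℂ) (fun j ↦ ofRealForm (-(r j))) (ofRealForm (-(r (Fin.last n))))))
          h2' p q).toQuadraticMap =
        sigNeg (hrFormPQ Φ e (hrSign m p q) (wedgeFamily (n + 2) fun j ↦ ofRealForm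
          (-(Fin.snoc (α := fun _ ↦ E [⋀^Fin 2]→L[ℝ] ℝ) r (r (Fin.last n)) j))) h2' p q).toQuadraticMap := by
      rw [hrSign_succ_succ, hrFormPQ_toQuadraticMap_neg_sign, sigPos_neg, ofRealForm_neg_snoc]
    rw [h1, h3, h4]
  -- (3) both indices are constant along the cones of positive backgrounds
  have ht₀ := const_mem_positiveTuples (ht (Fin.last n)).1 (ht (Fin.last n)).2 (n + 1)
  have hS : sigPos (hrFormPQ Φ e (hrSign (m + 2) (p + 1) (q + 1)) (wedgeFamily n (Fin.init fun j ↦ ofRealForm (-(t j))))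
        h2 (p + 1) (q + 1)).toQuadraticMap =
      sigPos (hrFormPQ Φ e (hrSign (m + 2) (p + 1) (q + 1)) (wedgeFamily n (Fin.init fun _ : Fin (n + 1) ↦
        ofRealForm (-(t (Fin.last n))))) h2 (p + 1) (q + 1)).toQuadraticMap :=
    (sigPos_sigNeg_hrFormPQ_eq_of_mem_positiveTuples Φ e hnk (by omega) h2 hHL₁ (castSucc_mem_positiveTuples ht)
      (const_mem_positiveTuples (ht (Fin.last n)).1 (ht (Fin.last n)).2 n)).1
  have hN : sigNeg (hrFormPQ Φ e (hrSign m p q) (wedgeFamily (n + 2) fun j ↦ ofRealForm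
          (-(Fin.snoc (α := fun _ ↦ E [⋀^Fin 2]→L[ℝ] ℝ) t (t (Fin.last n)) j))) h2' p q).toQuadraticMap =
      sigNeg (hrFormPQ Φ e (hrSign m p q) (wedgeFamily (n + 2) fun j ↦ ofRealForm
          (-(Fin.snoc (α := fun _ ↦ E [⋀^Fin 2]→L[ℝ] ℝ) (fun _ : Fin (n + 1) ↦ t (Fin.last n))
            (t (Fin.last n)) j))) h2' p q).toQuadraticMap :=
    (sigPos_sigNeg_hrFormPQ_eq_of_mem_positiveTuples Φ e (show (n + 2) + m = g by omega) hpq h2' hHL₂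
      (snoc_mem_positiveTuples ht) (snoc_mem_positiveTuples ht₀)).2
  -- (4) the classical point `(θ_n, …, θ_n)` and (5) the dimensions
  have h0 : ((hrFormPQ Φ e (hrSign (m + 2) (p + 1) (q + 1)) (wedgeFamily n (Fin.init fun _ : Fin (n + 1) ↦
        ofRealForm (-(t (Fin.last n))))) h2 (p + 1) (q + 1)).toQuadraticMap.restrict
      (primitiveReal (fun _ : Fin (n + 1) ↦ ofRealForm (-(t (Fin.last n)))) (m + 2) (p + 1) (q + 1))).PosDef :=
    posDef_hrFormPQ_restrict_primitiveReal_const Φ e (k := m + 2) (p := p + 1) (q := q + 1) hnk (by omega) h2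
      (ht (Fin.last n)).1 (ht (Fin.last n)).2
  have e3 := sigPos_eq_finrank_of_posDef h0
  have hdim : finrank ℝ ↥(primitiveReal (fun j ↦ ofRealForm (-(t j))) (m + 2) (p + 1) (q + 1)) =
      finrank ℝ ↥(primitiveReal (fun _ : Fin (n + 1) ↦ ofRealForm (-(t (Fin.last n)))) (m + 2) (p + 1) (q + 1)) := by
    rw [finrank_primitiveReal_succ_succ hg hpq hnk (hΘ ht) (hHL₂' ht),
      finrank_primitiveReal_succ_succ hg hpq hnk (hΘ ht₀) (hHL₂' ht₀)]
  have e1 := hsplit ht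
  have e2 : sigPos (hrFormPQ Φ e (hrSign (m + 2) (p + 1) (q + 1)) (wedgeFamily n (Fin.init fun _ : Fin (n + 1) ↦
          ofRealForm (-(t (Fin.last n))))) h2 (p + 1) (q + 1)).toQuadraticMap =
        sigPos ((hrFormPQ Φ e (hrSign (m + 2) (p + 1) (q + 1)) (wedgeFamily n (Fin.init fun _ : Fin (n + 1) ↦
          ofRealForm (-(t (Fin.last n))))) h2 (p + 1) (q + 1)).toQuadraticMap.restrict
          (primitiveReal (fun _ : Fin (n + 1) ↦ ofRealForm (-(t (Fin.last n)))) (m + 2) (p + 1) (q + 1))) +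
        sigNeg (hrFormPQ Φ e (hrSign m p q) (wedgeFamily (n + 2) fun j ↦ ofRealForm
          (-(Fin.snoc (α := fun _ ↦ E [⋀^Fin 2]→L[ℝ] ℝ) (fun _ : Fin (n + 1) ↦ t (Fin.last n))
            (t (Fin.last n)) j))) h2' p q).toQuadraticMap :=
    hsplit ht₀
  -- conclusion: `b⁺(h_t|P_t) = dim P_t`
  refine posDef_of_finrank_le_sigPos (le_of_eq ?_)
  rw [hdim]
  omega

end Deformation

/-! ## §3 From positive definiteness to the inequality on complex frames -/

section Frame

variable {ι : Type*} [Fintype ι] [DecidableEq ι] {E : Type*} [NormedAddCommGroup E] [NormedSpace ℂ E]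
  (Φ : (ι → ℝ) ≃L[ℝ] E)

/-- `h(A, A) > 0 ⇒ ε (Ω ∧ A ∧ Ā)(u_1, iu_1, …, u_g, iu_g) > 0` for every complex basis `u`.
[cite: DinhNguyen2006, §2 Prop. 2.1 (b) (arXiv PDF p. 5)] [cite: Lange2023AbelianVarietiesComplex, §1.7.2 Lemma 1.7.5] -/
theorem hrSign_mul_apply_interleave_pos_of_hrFormPQ_self_pos {g n k p q : ℕ} (e : Fin (2 * g) ≃ ι) (hpq : p + q = k)
    (h2 : 2 * n + (k + k) = 2 * g) {Ω : E [⋀^Fin (2 * n)]→L[ℝ] ℂ} (hΩ : conjForm Ω = Ω) {A : E [⋀^Fin k]→L[ℝ] ℂ}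
    (hA : A ∈ typeSubmodule E k p q)
    (hpos : 0 < hrFormPQ Φ e (hrSign k p q) Ω h2 p q ⟨A, hA⟩ ⟨A, hA⟩) (u : Module.Basis (Fin g) ℂ E) :
    0 < hrSign k p q * (Ω.wedge (A.wedge (conjForm A)))
      ((fun i ↦ Sum.elim (⇑u) (fun j ↦ I • u j) (finTwoMulEquivSum g i)) ∘ Fin.cast h2) :=
  (hrSign_mul_apply_interleave_pos_iff Φ e _ Ω h2 u A).2
    ((hrPairing_self_pos_iff Φ e _ Ω h2 hΩ (conj_hrSign hpq) A).2 hpos)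

omit [Fintype ι] [DecidableEq ι] in
/-- `(α ∧ β)(v) = α() β()` for `0`-forms. [cite: WarnerGTM94, 2.6] -/
private theorem wedge_apply_of_eq_zero {k l : ℕ} (hk : k = 0) (hl : l = 0) (α : E [⋀^Fin k]→L[ℝ] ℂ)
    (β : E [⋀^Fin l]→L[ℝ] ℂ) (v : Fin (k + l) → E) (v₁ : Fin k → E) (v₂ : Fin l → E) :
    (α.wedge β) v = α v₁ * β v₂ := by
  subst hk hl
  have hβ : β = (β v₂) • oneForm₀ E := by
    ext w
    rw [ContinuousAlternatingMap.smul_apply, Literature.Analysis.Complex.oneForm₀_apply, smul_eq_mul, mul_one,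
      Subsingleton.elim w v₂]
  have hv : α v = α v₁ := congrArg α (Subsingleton.elim _ _)
  rw [hβ, wedge_smul_right_complex, wedge_oneForm₀, ContinuousAlternatingMap.smul_apply,
    ContinuousAlternatingMap.smul_apply, Literature.Analysis.Complex.oneForm₀_apply, smul_eq_mul, smul_eq_mul, mul_one,
    mul_comm, hv]

end Frame

/-! ## §4 Timorin's induction: mixed Hodge–Riemann in every bidegree -/

section Induction

/-- **Timorin's theorem (mixed Hodge–Riemann bilinear relations, every bidegree), frame form, by induction on
`dim E`.** For real `2`-forms `θ_0, …, θ_n` on `E` (`dim_ℂ E = n + p + q`) with every `θ_j(i·, ·)` positive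
definite and `θ_j(i·, i·) = θ_j`, every complex basis `u` of `E`, and every NON-ZERO form `A` of type `(p, q)`
which is mixed primitive (`θ_0 ∧ ⋯ ∧ θ_n ∧ A = 0`):
`ε(p+q, p, q) · ((-θ_0)_ℂ ∧ ⋯ ∧ (-θ_{n-1})_ℂ ∧ A ∧ Ā)(u_1, iu_1, …, u_g, iu_g) > 0`,
`ε(k, p, q) = (-1)^{k(k-1)/2} i^{p-q}`. Induction step `g - 1 ⇒ g`: mixed hard Lefschetz on `E` from the
statement on hyperplanes (T3, `eq_zero_of_wedgeFamily_wedge_eq_zero_of_hyperplanes`), then the deformation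
argument (§2) on the torus `E/Φ(ℤ^{2g})` for an auxiliary real frame `Φ`. [cite: Timorin1998, Main Theorem]
[cite: DinhNguyen2006, §2 Prop. 2.1 (b) (arXiv PDF p. 5)] [cite: Cattani2008MixedLefschetz, Thm. 2.2] -/
theorem mixedHodgeRiemann_frame_aux (N : ℕ) :
    ∀ {E : Type u} [NormedAddCommGroup E] [NormedSpace ℂ E] [FiniteDimensional ℂ E], finrank ℂ E = N →
    ∀ {n k p q : ℕ}, n + k = N → p + q = k → ∀ (hc : 2 * n + (k + k) = 2 * (n + k))
      (θ : Fin (n + 1) → E [⋀^Fin 2]→L[ℝ] ℝ), θ ∈ positiveTuples E (n + 1) →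
    ∀ {A : E [⋀^Fin k]→L[ℝ] ℂ}, A ∈ typeSubmodule E k p q →
      (wedgeFamily (n + 1) fun j ↦ ofRealForm (-(θ j))).wedge A = 0 → A ≠ 0 →
    ∀ u : Module.Basis (Fin (n + k)) ℂ E,
      0 < hrSign k p q * ((wedgeFamily n fun j ↦ ofRealForm (-(θ (Fin.castSucc j)))).wedge (A.wedge (conjForm A)))
        ((fun i ↦ Sum.elim (⇑u) (fun j ↦ I • u j) (finTwoMulEquivSum (n + k) i)) ∘ Fin.cast hc) := by
  induction N with
  | zero =>
    intro E _ _ _ hg n k p q hnk hpq hc θ hθ A hA hprim hA0 u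
    obtain rfl : n = 0 := by omega
    obtain rfl : k = 0 := by omega
    obtain rfl : p = 0 := by omega
    obtain rfl : q = 0 := by omega
    have hε : hrSign 0 0 0 = 1 := by simp [hrSign]
    have ha : A (fun i ↦ i.elim0) ≠ 0 := by
      intro h0
      apply hA0
      ext w
      rw [Subsingleton.elim w (fun i ↦ i.elim0), h0, ContinuousAlternatingMap.coe_zero, Pi.zero_apply]
    have hv : ((wedgeFamily 0 fun j ↦ ofRealForm (-(θ (Fin.castSucc j)))).wedge (A.wedge (conjForm A)))
        ((fun i ↦ Sum.elim (⇑u) (fun j ↦ I • u j) (finTwoMulEquivSum (0 + 0) i)) ∘ Fin.cast hc) =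
        A (fun i ↦ i.elim0) * conj (A (fun i ↦ i.elim0)) := by
      rw [wedge_apply_of_eq_zero (by norm_num) (by norm_num) _ _ _ (fun i ↦ Fin.elim0 (i.cast (by norm_num)))
        (fun i ↦ Fin.elim0 (i.cast (by norm_num))),
        wedge_apply_of_eq_zero rfl rfl _ _ _ (fun i ↦ i.elim0) (fun i ↦ i.elim0), conjForm_apply]
      have h1 : (wedgeFamily 0 fun j ↦ ofRealForm (-(θ (Fin.castSucc j)))) (fun i ↦ Fin.elim0 (i.cast (by norm_num))) = 1 :=
        rfl
      rw [h1, one_mul]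
    rw [hε, one_mul, hv, Complex.mul_conj, Complex.zero_lt_real]
    exact Complex.normSq_pos.2 ha
  | succ N ih =>
    intro E _ _ _ hg n k p q hnk hpq hc θ hθ A hA hprim hA0 u
    -- (1) mixed hard Lefschetz on `E`, from the statement on hyperplanes (T3)
    have HL : ∀ {n' k' p' q' : ℕ}, n' + 1 + k' = N + 1 → p' + q' = k' →
        ∀ θ' ∈ positiveTuples E (n' + 1), ∀ A' ∈ typeSubmodule E k' p' q',
          (wedgeFamily (n' + 1) fun j ↦ ofRealForm (-(θ' j))).wedge A' = 0 → A' = 0 := by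
      intro n' k' p' q' h' hpq' θ' hθ' A' hA' h0
      refine eq_zero_of_wedgeFamily_wedge_eq_zero_of_hyperplanes hg h' hpq' (by omega) θ' (hθ' (Fin.last n')).1
        (hθ' (Fin.last n')).2 (hrSign k' p' q') (fun S uS A'' hA'' hprim'' hne ↦ ?_) hA' h0
      have hS : finrank ℂ ↥S = N := by
        have h := Module.finrank_eq_card_basis uS
        rw [Fintype.card_fin] at h
        omega
      exact ih hS (by omega) hpq' _ (fun j ↦ (θ' j).compContinuousLinearMap (S.subtypeL.restrictScalars ℝ))
        (fun j ↦ ⟨restrict_apply_I_smul (θ' j) S (hθ' j).1, fun v hv ↦ restrict_apply_I_smul_self_pos (θ' j) S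
          (hθ' j).2 v hv⟩) hA'' hprim'' hne uS
    -- in particular for backgrounds of length `n` on `Λ^{p,q}` (trivial for `n = 0`)
    have hHLn : ∀ s ∈ positiveTuples E n, ∀ A' ∈ typeSubmodule E k p q,
        (wedgeFamily n fun j ↦ ofRealForm (-(s j))).wedge A' = 0 → A' = 0 := by
      intro s hs A' hA' h0
      rcases Nat.eq_zero_or_pos n with hn | hn
      · subst hn
        exact eq_zero_of_wedgeFamily_zero_wedge_eq_zero _ h0
      · obtain ⟨n', rfl⟩ := Nat.exists_eq_succ_of_ne_zero hn.ne'
        exact HL (by omega) hpq s hs A' hA' h0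
    -- an auxiliary torus structure `E = ℝ^{2g}/ℤ^{2g}`
    have hg' : finrank ℂ E = n + k := by omega
    obtain ⟨Φ⟩ := nonempty_continuousLinearEquiv_of_finrank_eq hg'
    -- (2) `h_θ(A, A) > 0` by the deformation argument
    have hreal : conjForm (wedgeFamily n fun j ↦ ofRealForm (-(θ (Fin.castSucc j)))) =
        wedgeFamily n fun j ↦ ofRealForm (-(θ (Fin.castSucc j))) :=
      conjForm_wedgeFamily_of_real (conjForm_ofRealForm_neg_family fun j ↦ θ (Fin.castSucc j))
    have key : 0 < hrFormPQ Φ (Equiv.refl _) (hrSign k p q) (wedgeFamily n fun j ↦ ofRealForm (-(θ (Fin.castSucc j))))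
        hc p q ⟨A, hA⟩ ⟨A, hA⟩ := by
      rcases Nat.eq_zero_or_pos p with hp | hp
      · -- bidegree `(0, k)`: everything is primitive
        subst hp
        obtain rfl : q = k := by omega
        have hpd := posDef_hrFormPQ_of_primitiveReal_eq_top Φ (Equiv.refl _) rfl hpq hc hHLn
          (fun t ht ↦ primitiveReal_eq_top_of_fst_eq_zero hg' rfl (isOfTypeAt_of_mem_positiveTuples ht)) hθ
        have h1 := hpd ⟨A, hA⟩ (fun h ↦ hA0 (congrArg Subtype.val h))
        rwa [hrFormPQ_toQuadraticMap_apply] at h1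
      rcases Nat.eq_zero_or_pos q with hq | hq
      · -- bidegree `(k, 0)`
        subst hq
        obtain rfl : p = k := by omega
        have hpd := posDef_hrFormPQ_of_primitiveReal_eq_top Φ (Equiv.refl _) rfl hpq hc hHLn
          (fun t ht ↦ primitiveReal_eq_top_of_snd_eq_zero hg' rfl (isOfTypeAt_of_mem_positiveTuples ht)) hθ
        have h1 := hpd ⟨A, hA⟩ (fun h ↦ hA0 (congrArg Subtype.val h))
        rwa [hrFormPQ_toQuadraticMap_apply] at h1
      -- bidegree `(p'+1, q'+1)`: the mixed Lefschetz decomposition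
      obtain ⟨p', rfl⟩ := Nat.exists_eq_succ_of_ne_zero hp.ne'
      obtain ⟨q', rfl⟩ := Nat.exists_eq_succ_of_ne_zero hq.ne'
      obtain rfl : k = p' + q' + 2 := by omega
      have hHL₂ : ∀ s ∈ positiveTuples E (n + 2), ∀ C ∈ typeSubmodule E (p' + q') p' q',
          (wedgeFamily (n + 2) fun j ↦ ofRealForm (-(s j))).wedge C = 0 → C = 0 :=
        fun s hs C hC h0 ↦ HL (by omega) rfl s hs C hC h0
      have hpd := posDef_hrFormPQ_restrict_primitiveReal Φ (Equiv.refl _) hg' (rfl : p' + q' = p' + q') (by omega) hc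
        (by omega) hHLn hHL₂ hθ
      have hP : (⟨A, hA⟩ : ↥((typeSubmodule E (p' + q' + 2) (p' + 1) (q' + 1)).restrictScalars ℝ)) ∈
          primitiveReal (fun j ↦ ofRealForm (-(θ j))) (p' + q' + 2) (p' + 1) (q' + 1) :=
        (mem_primitiveReal _ _).2 hprim
      have h1 := hpd ⟨⟨A, hA⟩, hP⟩ (fun h ↦ hA0 (congrArg Subtype.val (congrArg Subtype.val h)))
      rw [QuadraticMap.restrict_apply] at h1
      rwa [hrFormPQ_toQuadraticMap_apply] at h1
    exact hrSign_mul_apply_interleave_pos_of_hrFormPQ_self_pos Φ (Equiv.refl _) hpq hc hreal hA key u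

end Induction

/-! ## §5 The theorems: mixed Hodge–Riemann (frame form and `∫_X` form), mixed hard Lefschetz, and Dinh–Nguyên's
Prop. 2.1 (b) on a complex torus, in every bidegree -/

section Main

/-- **Mixed Hodge–Riemann bilinear relations on a complex vector space, every bidegree (Timorin), frame form.**
For positive real `(1,1)`-forms `θ_0, …, θ_n` on `E`, `dim_ℂ E = n + p + q`, a non-zero form `A` of type `(p,q)`
with `θ_0 ∧ ⋯ ∧ θ_n ∧ A = 0`, and any complex basis `u`:
`ε(p+q,p,q) · ((-θ_0)_ℂ ∧ ⋯ ∧ (-θ_{n-1})_ℂ ∧ A ∧ Ā)(u_1, iu_1, …) > 0`. [cite: Timorin1998, Main Theorem]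
[cite: DinhNguyen2006, §2 Prop. 2.1 (b) (arXiv PDF p. 5)] [cite: Cattani2008MixedLefschetz, Thm. 2.2] -/
theorem mixedHodgeRiemann_frame {E : Type u} [NormedAddCommGroup E] [NormedSpace ℂ E] [FiniteDimensional ℂ E]
    {n k p q : ℕ} (hg : finrank ℂ E = n + k) (hpq : p + q = k) (hc : 2 * n + (k + k) = 2 * (n + k))
    {θ : Fin (n + 1) → E [⋀^Fin 2]→L[ℝ] ℝ} (hθ : θ ∈ positiveTuples E (n + 1))
    {A : E [⋀^Fin k]→L[ℝ] ℂ} (hA : A ∈ typeSubmodule E k p q)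
    (hprim : (wedgeFamily (n + 1) fun j ↦ ofRealForm (-(θ j))).wedge A = 0) (hA0 : A ≠ 0)
    (u : Module.Basis (Fin (n + k)) ℂ E) :
    0 < hrSign k p q * ((wedgeFamily n fun j ↦ ofRealForm (-(θ (Fin.castSucc j)))).wedge (A.wedge (conjForm A)))
      ((fun i ↦ Sum.elim (⇑u) (fun j ↦ I • u j) (finTwoMulEquivSum (n + k) i)) ∘ Fin.cast hc) :=
  mixedHodgeRiemann_frame_aux (n + k) hg rfl hpq hc θ hθ hA hprim hA0 u

/-- **Mixed hard Lefschetz on a complex vector space, every bidegree**: for positive real `(1,1)`-forms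
`θ_0, …, θ_n` on `E` with `dim_ℂ E = n + 1 + p + q`, `A ↦ θ_0 ∧ ⋯ ∧ θ_n ∧ A` is injective on the forms of type
`(p, q)` (Dinh–Nguyên's Prop. 2.1 (a) / Theorem A for constant forms). [cite: DinhNguyen2006, §2 Prop. 2.1 (a) (arXiv PDF p. 5)]
[cite: Timorin1998, Main Theorem] [cite: Cattani2008MixedLefschetz, Thm. 2.2] -/
theorem mixedHardLefschetz_of_pos {E : Type u} [NormedAddCommGroup E] [NormedSpace ℂ E] [FiniteDimensional ℂ E]
    {n k p q : ℕ} (hg : finrank ℂ E = n + 1 + k) (hpq : p + q = k)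
    {θ : Fin (n + 1) → E [⋀^Fin 2]→L[ℝ] ℝ} (hθ : θ ∈ positiveTuples E (n + 1))
    {A : E [⋀^Fin k]→L[ℝ] ℂ} (hA : A ∈ typeSubmodule E k p q)
    (h0 : (wedgeFamily (n + 1) fun j ↦ ofRealForm (-(θ j))).wedge A = 0) : A = 0 := by
  refine eq_zero_of_wedgeFamily_wedge_eq_zero_of_hyperplanes hg rfl hpq (by omega) θ (hθ (Fin.last n)).1
    (hθ (Fin.last n)).2 (hrSign k p q) (fun S uS A' hA' hprim' hne ↦ ?_) hA h0
  have hS : finrank ℂ ↥S = n + k := by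
    rw [Module.finrank_eq_card_basis uS, Fintype.card_fin]
  exact mixedHodgeRiemann_frame (E := ↥S) hS hpq _
    (θ := fun j ↦ (θ j).compContinuousLinearMap (S.subtypeL.restrictScalars ℝ))
    (fun j ↦ ⟨restrict_apply_I_smul (θ j) S (hθ j).1, fun v hv ↦ restrict_apply_I_smul_self_pos (θ j) S
      (hθ j).2 v hv⟩) hA' hprim' hne uS

/-- Mixed hard Lefschetz for a positive background of any length `r` (`r = 0`: trivial).
[cite: DinhNguyen2006, §2 Prop. 2.1 (a) (arXiv PDF p. 5)] -/
theorem mixedHardLefschetz_of_pos_length {E : Type u} [NormedAddCommGroup E] [NormedSpace ℂ E]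
    [FiniteDimensional ℂ E] {r k p q : ℕ} (hg : finrank ℂ E = r + k) (hpq : p + q = k)
    {s : Fin r → E [⋀^Fin 2]→L[ℝ] ℝ} (hs : s ∈ positiveTuples E r)
    {A : E [⋀^Fin k]→L[ℝ] ℂ} (hA : A ∈ typeSubmodule E k p q)
    (h0 : (wedgeFamily r fun j ↦ ofRealForm (-(s j))).wedge A = 0) : A = 0 := by
  rcases Nat.eq_zero_or_pos r with hr | hr
  · subst hr
    exact eq_zero_of_wedgeFamily_zero_wedge_eq_zero _ h0
  · obtain ⟨n, rfl⟩ := Nat.exists_eq_succ_of_ne_zero hr.ne'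
    exact mixedHardLefschetz_of_pos hg hpq hs hA h0

variable {ι : Type*} [Fintype ι] [DecidableEq ι] {E : Type u} [NormedAddCommGroup E] [NormedSpace ℂ E]
  (Φ : (ι → ℝ) ≃L[ℝ] E)

/-- **Mixed Hodge–Riemann bilinear relations on a complex torus `X = E/Λ`, every bidegree**: for positive real
`(1,1)`-forms `θ_0, …, θ_n`, `dim_ℂ X = n + p + q`, and a non-zero constant form `A` of type `(p, q)` with
`θ_0 ∧ ⋯ ∧ θ_n ∧ A = 0`: **`ε(p+q,p,q) ∫_X (-θ_0)_ℂ ∧ ⋯ ∧ (-θ_{n-1})_ℂ ∧ A ∧ Ā > 0`** (Dinh–Nguyên's `Q(A, A) > 0`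
on `P^{p,q}`, Prop. 2.1 (b); Timorin's linear theorem). [cite: Timorin1998, Main Theorem]
[cite: DinhNguyen2006, §2 Prop. 2.1 (b) and §1 Thm. 1.3 (arXiv PDF pp. 2, 5)] [cite: Cattani2008MixedLefschetz, Thm. 2.2] -/
theorem mixedHodgeRiemann_torusIntegral_pos {n k p q : ℕ} (e : Fin (2 * (n + k)) ≃ ι) (hg : finrank ℂ E = n + k)
    (hpq : p + q = k) (h2 : 2 * n + (k + k) = 2 * (n + k))
    {θ : Fin (n + 1) → E [⋀^Fin 2]→L[ℝ] ℝ} (hθ : θ ∈ positiveTuples E (n + 1))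
    {A : E [⋀^Fin k]→L[ℝ] ℂ} (hA : A ∈ typeSubmodule E k p q)
    (hprim : (wedgeFamily (n + 1) fun j ↦ ofRealForm (-(θ j))).wedge A = 0) (hA0 : A ≠ 0) :
    0 < hrSign k p q * torusIntegral Φ e (((wedgeFamily n fun j ↦ ofRealForm (-(θ (Fin.castSucc j)))).wedge
      (A.wedge (conjForm A))).domDomCongr (finCongr h2)) := by
  haveI := finiteDimensional_complex Φ
  have u : Module.Basis (Fin (n + k)) ℂ E := Module.finBasisOfFinrankEq ℂ E hg
  have h := (hrSign_mul_apply_interleave_pos_iff Φ e (hrSign k p q) _ h2 u A).1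
    (mixedHodgeRiemann_frame hg hpq h2 hθ hA hprim hA0 u)
  rwa [hrPairing_apply] at h

/-- **Dinh–Nguyên's Prop. 2.1 (b) on a complex torus, bidegree `(p+1, q+1)`**: the real symmetric form
`h = Re(ε ∫_X θ_0 ∧ ⋯ ∧ θ_{n-1} ∧ A ∧ B̄)` is POSITIVE DEFINITE on the mixed primitive forms
`{A ∈ Λ^{p+1,q+1} : θ_0 ∧ ⋯ ∧ θ_n ∧ A = 0}`, for every positive background — unconditionally (mixed hard
Lefschetz being a theorem, `mixedHardLefschetz_of_pos`). [cite: DinhNguyen2006, §2 Prop. 2.1 (b) (arXiv PDF p. 5)]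
[cite: Timorin1998, Main Theorem] -/
theorem posDef_hrFormPQ_restrict_primitiveReal_of_pos {n m p q : ℕ} (e : Fin (2 * (n + (m + 2))) ≃ ι)
    (hg : finrank ℂ E = n + (m + 2)) (hpq : p + q = m) (h2 : 2 * n + ((m + 2) + (m + 2)) = 2 * (n + (m + 2)))
    {t : Fin (n + 1) → E [⋀^Fin 2]→L[ℝ] ℝ} (ht : t ∈ positiveTuples E (n + 1)) :
    ((hrFormPQ Φ e (hrSign (m + 2) (p + 1) (q + 1)) (wedgeFamily n (Fin.init fun j ↦ ofRealForm (-(t j)))) h2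
        (p + 1) (q + 1)).toQuadraticMap.restrict (primitiveReal (fun j ↦ ofRealForm (-(t j))) (m + 2) (p + 1) (q + 1))).PosDef :=
  haveI := finiteDimensional_complex Φ
  posDef_hrFormPQ_restrict_primitiveReal Φ e hg hpq rfl h2 (by omega)
    (fun _ hs _ hA h0 ↦ mixedHardLefschetz_of_pos_length hg (by omega) hs hA h0)
    (fun _ hs _ hC h0 ↦ mixedHardLefschetz_of_pos_length (by omega) hpq hs hC h0) ht

/-- **Dinh–Nguyên's Prop. 2.1 (b), bidegrees `(0, k)` and `(k, 0)`**: there every form is primitive and `h` is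
positive definite on all of `Λ^{p,q}`. [cite: DinhNguyen2006, §2 Prop. 2.1 (b) (arXiv PDF p. 5)] [cite: Timorin1998, Main Theorem] -/
theorem posDef_hrFormPQ_of_pos_of_fst_eq_zero_or_snd_eq_zero {n k p q : ℕ} (e : Fin (2 * (n + k)) ≃ ι)
    (hg : finrank ℂ E = n + k) (hpq : p + q = k) (h0 : p = 0 ∨ q = 0) (h2 : 2 * n + (k + k) = 2 * (n + k))
    {t : Fin (n + 1) → E [⋀^Fin 2]→L[ℝ] ℝ} (ht : t ∈ positiveTuples E (n + 1)) :
    (hrFormPQ Φ e (hrSign k p q) (wedgeFamily n fun j ↦ ofRealForm (-(t (Fin.castSucc j)))) h2 p q).toQuadraticMap.PosDef := by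
  haveI := finiteDimensional_complex Φ
  refine posDef_hrFormPQ_of_primitiveReal_eq_top Φ e rfl hpq h2
    (fun _ hs _ hA h ↦ mixedHardLefschetz_of_pos_length hg hpq hs hA h) (fun s hs ↦ ?_) ht
  rcases h0 with rfl | rfl
  · obtain rfl : q = k := by omega
    exact primitiveReal_eq_top_of_fst_eq_zero hg rfl (isOfTypeAt_of_mem_positiveTuples hs)
  · obtain rfl : p = k := by omega
    exact primitiveReal_eq_top_of_snd_eq_zero hg rfl (isOfTypeAt_of_mem_positiveTuples hs)

end Main

end ComplexTorus

end Literature.Geometry.Kaehler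

end
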